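import Literature.AnabelianGeometry.SemiGraphs.TemperedReconstructionR2bProofs
import HarnessLib

/-!
# [SemiAnbd] Cor. 3.9, step (b), anabelioid level — part 2: the locally open morphism `G → H` of a
# compatibly quasi-geometric homomorphism (residual R2′ `QuasiGeometricGraphDataCompat`)

Mochizuki, *Semi-graphs of anabelioids*, Publ. RIMS **42** (2006) [MochizukiSemiAnbd2006], Cor. 3.9,
proof, PRIMS pp. 267–268 (kurims pp. 42–43) [cite: MochizukiSemiAnbd2006, Cor 3.9 pp.42-43].
PROOF-ONLY (no definitions; cell abc-iut, layer L3, sub-node «R2 remainder (b2)»).  Main theorem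
`exists_hom_of_isQuasiGeometric_of_compat`: from Thm 3.7 (i)–(iv) and `EdgeLikeDistinct` (HYPOTHESES),
for `G`, `H` as in Cor. 3.9 and a quasi-geometric `φ` satisfying the compatibility clause of the
compatible reading of Def. 3.8 (`hcompat` = the field `IsCompatiblyQuasiGeometric.compat` of
abc-iut-L3-t2's `TemperedQuasiGeometricCompatible.lean`, verbatim), there is a morphism of semi-graphs of
anabelioids `F : G → H` (`ProfiniteSemiGraph.Hom`, 2-cells `comm` included) which is locally open and
compatible with `φ` on verticial and edge homomorphisms up to conjugation — the body of the twin residual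
`QuasiGeometricGraphDataCompat` (ruling χ2).  Vertex/edge maps = t2's `f_V`, `f_E`; `hV`, `hE` = lifts of
`φ ∘ ψ_v`, `φ ∘ ψ_e` through injective verticial / edge homomorphisms of `H`; the BRANCH map = the branch
singled out by the host of the image of the edge group (part 1, `exists_target_branch_comm`) — in the
loop case `f_V v₁ = f_V v₂` only this choice carries the 2-cell; injectivity on the branches of an edge
is exactly non-folding (`hcompat` + `host_eq_of_mapsOnto` + `host_unique_of_branch`); local openness from
"maps onto an open subgroup".  Without `hcompat` the statement is false (the "fold"
`Π_{v₁} *_{Π_e} Π_{v₂} → Π_w`, findings W4d083-F1 / t2g2-F1).  Nothing here takes a side on [IUTchIII]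
Cor. 3.12; typed ≠ discharged.
-/

open CategoryTheory Topology

namespace Literature.AnabelianGeometry.SemiGraphs

namespace ProfiniteSemiGraph

universe u
variable {𝒢 ℋ : ProfiniteSemiGraph.{u}}

/-- **Host of an edge-like subgroup through a branch is well defined** ([SemiAnbd] Thm 3.7 (iii) p. 41
with total estrangement): if `Ψ_w(Π_{b'})` contains both `k₁·E·k₁⁻¹` and `k₂·E·k₂⁻¹` for the range `E`
of an edge homomorphism at `edgeOf b'`, then `k₁⁻¹·Ψ_w(Π_w)·k₁ = k₂⁻¹·Ψ_w(Π_w)·k₂`.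
[cite: MochizukiSemiAnbd2006, Thm 3.7(iii) p.41] -/
theorem host_unique_of_branch (h37i : VerticialInjective.{u}) (h37ii : VerticialDistinct.{u})
    (h37iii : CompactInVerticial.{u}) (hℋ : Cor39Hypotheses ℋ) (c : TemperedPiChart ℋ)
    (Ψ : ∀ w : ℋ.graph.Vertex, ℋ.Gv w →ₜ* c.G) (hΨ : ∀ w, IsVerticialHom c w (Ψ w))
    {e' : ℋ.graph.Edge} (χ : ℋ.Ge e' →ₜ* c.G) (hχ : IsEdgeHom c e' χ)
    {w : ℋ.graph.Vertex} {b' : ℋ.graph.Branch} (h' : ℋ.graph.abuts b' = some w)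
    (q : ℋ.graph.edgeOf b' = e') (k₁ k₂ : c.G)
    (hk₁ : χ.toMonoidHom.range.map (MulAut.conj k₁).toMonoidHom ≤
      (ℋ.branchSubgroup b' w h').map (Ψ w).toMonoidHom)
    (hk₂ : χ.toMonoidHom.range.map (MulAut.conj k₂).toMonoidHom ≤
      (ℋ.branchSubgroup b' w h').map (Ψ w).toMonoidHom) :
    (Ψ w).toMonoidHom.range.map (MulAut.conj k₁⁻¹).toMonoidHom =
      (Ψ w).toMonoidHom.range.map (MulAut.conj k₂⁻¹).toMonoidHom := by
  classical
  haveI := TemperedPiChart.t2Space c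
  have hℋ37 := hℋ.thm37Hypotheses
  have hEmem : χ.toMonoidHom.range ∈ edgeLikeSubgroups c e' := ⟨χ, hχ, rfl⟩
  haveI := infinite_of_mem_edgeLikeSubgroups h37i hℋ37 c hEmem
  have hEne : χ.toMonoidHom.range ≠ ⊥ := fun h0 => by
    rw [h0] at hEmem
    haveI := infinite_of_mem_edgeLikeSubgroups h37i hℋ37 c hEmem
    exact not_finite (⊥ : Subgroup c.G)
  have hEc : IsCompact ((χ.toMonoidHom.range : Subgroup c.G) : Set c.G) :=
    isCompact_of_mem_edgeLikeSubgroups c hEmem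
  -- `E ≤ kⱼ⁻¹ · Ψ(Π_{b'}) · kⱼ`
  have hle : ∀ k : c.G, χ.toMonoidHom.range.map (MulAut.conj k).toMonoidHom ≤
      (ℋ.branchSubgroup b' w h').map (Ψ w).toMonoidHom →
      χ.toMonoidHom.range ≤ ((ℋ.branchSubgroup b' w h').map (Ψ w).toMonoidHom).map
        (MulAut.conj k⁻¹).toMonoidHom := by
    intro k hk x hx
    refine ⟨k * x * k⁻¹, hk ⟨x, hx, rfl⟩, ?_⟩
    simp only [MulEquiv.coe_toMonoidHom, MulAut.conj_apply]
    group
  have hE₁ := hle k₁ hk₁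
  have hE₂ := hle k₂ hk₂
  set W₁ := (Ψ w).toMonoidHom.range.map (MulAut.conj k₁⁻¹).toMonoidHom with hW₁def
  set W₂ := (Ψ w).toMonoidHom.range.map (MulAut.conj k₂⁻¹).toMonoidHom with hW₂def
  have hW₁ : W₁ ∈ verticialSubgroups c w :=
    conj_mem_verticialSubgroups c (range_mem_verticialSubgroups c (Ψ w) (hΨ w)) k₁⁻¹
  have hW₂ : W₂ ∈ verticialSubgroups c w :=
    conj_mem_verticialSubgroups c (range_mem_verticialSubgroups c (Ψ w) (hΨ w)) k₂⁻¹
  have hEW₁ : χ.toMonoidHom.range ≤ W₁ := hE₁.trans (Subgroup.map_mono (Subgroup.map_le_range _ _))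
  have hEW₂ : χ.toMonoidHom.range ≤ W₂ := hE₂.trans (Subgroup.map_mono (Subgroup.map_le_range _ _))
  by_contra hne
  -- the other branch of `e'`
  obtain ⟨c₁, c₂, hc12, hc₁, hc₂, hall⟩ := ℋ.graph.two_branches e'
  obtain ⟨b'', hbb, q''⟩ : ∃ b'', b'' ≠ b' ∧ ℋ.graph.edgeOf b'' = e' := by
    rcases hall b' q with rfl | rfl
    · exact ⟨c₂, hc12.symm, hc₂⟩
    · exact ⟨c₁, hc12, hc₁⟩
  obtain ⟨w'', h''⟩ := Option.isSome_iff_exists.mp (hℋ.isGraph.abuts_isSome b'')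
  obtain ⟨k'', hk''⟩ := exists_conj_comp_brHomAt c h'' (Ψ w'') (hΨ w'') q'' χ hχ
  have hE'' : χ.toMonoidHom.range ≤ ((ℋ.branchSubgroup b'' w'' h'').map (Ψ w'').toMonoidHom).map
      (MulAut.conj k''⁻¹).toMonoidHom := by
    rintro _ ⟨y, rfl⟩
    refine ⟨Ψ w'' (ℋ.brHomAt b'' w'' h'' e' q'' y), ⟨_, brHomAt_mem_branchSubgroup h'' q'' y, rfl⟩, ?_⟩
    have hy : χ y = k''⁻¹ * Ψ w'' (ℋ.brHomAt b'' w'' h'' e' q'' y) * k''⁻¹⁻¹ := by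
      rw [← hk'' y]; group
    rw [MulEquiv.coe_toMonoidHom, MulAut.conj_apply, ContinuousMonoidHom.coe_toMonoidHom]
    exact hy.symm
  have hW'' : ((Ψ w'').toMonoidHom.range.map (MulAut.conj k''⁻¹).toMonoidHom) ∈ verticialSubgroups c w'' :=
    conj_mem_verticialSubgroups c (range_mem_verticialSubgroups c (Ψ w'') (hΨ w'')) k''⁻¹
  have hEW'' : χ.toMonoidHom.range ≤ (Ψ w'').toMonoidHom.range.map (MulAut.conj k''⁻¹).toMonoidHom :=
    hE''.trans (Subgroup.map_mono (Subgroup.map_le_range _ _))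
  -- Thm 3.7 (iii) applied to `E` with hosts `W₁ ≠ W₂`
  obtain ⟨honly, -⟩ := (h37iii ℋ hℋ37 c _ hEc).2 hEne w w W₁ W₂ hW₁ hW₂ hne hEW₁ hEW₂
  rcases honly w'' _ hW'' hEW'' with h1 | h2
  · exact hbb (branch_eq_of_hosts_eq h37ii h37i hℋ37 c Ψ hΨ hEne h'' h' k''⁻¹ k₁⁻¹ hE'' hE₁ h1)
  · exact hbb (branch_eq_of_hosts_eq h37ii h37i hℋ37 c Ψ hΨ hEne h'' h' k''⁻¹ k₂⁻¹ hE'' hE₂ h2)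

/-! ### Uniqueness of verticial hosts of finite-index subgroups (Thm 3.7 (ii)) -/

/-- Two verticial subgroups one of which has finite index over their intersection coincide
(Thm 3.7 (ii), both clauses). [cite: MochizukiSemiAnbd2006, Thm 3.7(ii) p.40] -/
theorem eq_of_relIndex_ne_zero_of_mem_verticialSubgroups (h37ii : VerticialDistinct.{u})
    (hℋ : ℋ.Thm37Hypotheses) (c : TemperedPiChart ℋ) {u u' : ℋ.graph.Vertex} {W W' : Subgroup c.G}
    (hW : W ∈ verticialSubgroups c u) (hW' : W' ∈ verticialSubgroups c u') (h : W'.relIndex W ≠ 0) :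
    W = W' := by
  have hu : u = u' := by
    by_contra hne
    exact h ((h37ii ℋ hℋ c).1 u u' W W' hW hW' hne)
  subst hu
  obtain ⟨g, rfl⟩ := exists_conj_of_mem_verticialSubgroups c hW hW'
  have hg : g ∈ W := by
    by_contra hg
    have h0 := (h37ii ℋ hℋ c).2 u W hW 1 g (by simpa using hg)
    have h1 : W.map (MulAut.conj (1 : c.G)).toMonoidHom = W := by ext; simp
    rw [h1] at h0
    exact h h0
  ext x
  constructor
  · intro hx
    exact ⟨g⁻¹ * x * g, W.mul_mem (W.mul_mem (W.inv_mem hg) hx) hg, by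
      simp [MulAut.conj_apply, mul_assoc]⟩
  · rintro ⟨y, hy, rfl⟩
    simpa [MulAut.conj_apply] using W.mul_mem (W.mul_mem hg hy) (W.inv_mem hg)

/-- The verticial host of the image of a subgroup mapped "onto an open subgroup of" a verticial
subgroup is unique. [cite: MochizukiSemiAnbd2006, Cor 3.9 p.42] -/
theorem host_eq_of_mapsOnto (h37ii : VerticialDistinct.{u}) (hℋ : ℋ.Thm37Hypotheses)
    (c : TemperedPiChart ℋ) {P : Type u} [Group P] (φ : P →* c.G) {X : Subgroup P}
    {u₀ u : ℋ.graph.Vertex} {W₀ W : Subgroup c.G} (hW₀ : W₀ ∈ verticialSubgroups c u₀)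
    (hm : MapsOntoOpenSubgroupOf φ X W₀) (hW : W ∈ verticialSubgroups c u) (hle : X.map φ ≤ W) :
    W = W₀ := by
  have h1 : (X.map φ).relIndex W₀ ≠ 0 :=
    relIndex_ne_zero_of_mapsOnto φ (isCompact_of_mem_verticialSubgroups c hW₀) hm
  have h2 : W.relIndex W₀ ≠ 0 := fun h0 => h1 (Subgroup.relIndex_eq_zero_of_le_left hle h0)
  exact (eq_of_relIndex_ne_zero_of_mem_verticialSubgroups h37ii hℋ c hW₀ hW h2).symm

/-- Openness of the range of a lift through an embedding. [folklore] -/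
private theorem isOpen_range_lift {A B C : Type*} [Group A] [TopologicalSpace A] [Group B]
    [TopologicalSpace B] [Group C] [TopologicalSpace C] (β : B →ₜ* C)
    (γ : A →ₜ* B) (S : Subgroup C) (hS : ∀ a, β (γ a) ∈ S)
    (hS' : ∀ b, β b ∈ S → b ∈ γ.toMonoidHom.range)
    (hopen : IsOpen ((Subtype.val : β.toMonoidHom.range → C) ⁻¹' (S : Set C))) :
    IsOpen (γ.toMonoidHom.range : Set B) := by
  let f : B → β.toMonoidHom.range := fun b => ⟨β b, ⟨b, rfl⟩⟩
  have hf : Continuous f := β.continuous.subtype_mk _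
  have hset : (γ.toMonoidHom.range : Set B) = f ⁻¹' ((Subtype.val : β.toMonoidHom.range → C) ⁻¹' (S : Set C)) := by
    ext b
    simp only [SetLike.mem_coe, Set.mem_preimage, f]
    constructor
    · rintro ⟨a, rfl⟩; exact hS a
    · exact hS' b
  rw [hset]
  exact hopen.preimage hf

/-! ### Corollary 3.9 (b), the anabelioid level: the locally open morphism `G → H` of a
(compatibly) quasi-geometric homomorphism -/

/-- **[SemiAnbd] Cor. 3.9, proof, pp. 267–268 — residual (R2′) of the reduction, compatible reading of
Def. 3.8 (`hcompat`; under the literal reading the "fold" `Π_{v₁} *_{Π_e} Π_{v₂} → Π_w` is quasi-geometric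
and admits NO such morphism):** from Thm 3.7 (i)–(iv) and `EdgeLikeDistinct`, a non-folding quasi-geometric
`φ : π₁^temp(G) → π₁^temp(H)` admits a locally open morphism of semi-graphs of anabelioids `F : G → H`
compatible with `φ` on verticial and edge homomorphisms up to conjugation (branch map chosen by the host
condition of `exists_target_branch_comm`; `hV`, `hE` = lifts through injective verticial / edge
homomorphisms of `H`). [cite: MochizukiSemiAnbd2006, Cor 3.9 pp.42-43] -/
theorem exists_hom_of_isQuasiGeometric_of_compat (h37i : VerticialInjective.{u})
    (h37ii : VerticialDistinct.{u}) (h37iii : CompactInVerticial.{u})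
    (h37iv : MaximalCompactIffVerticial.{u}) (hED : EdgeLikeDistinct.{u})
    (h𝒢 : Cor39Hypotheses 𝒢) (hℋ : Cor39Hypotheses ℋ) (c𝒢 : TemperedPiChart 𝒢)
    (cℋ : TemperedPiChart ℋ) (φ : c𝒢.G →ₜ* cℋ.G) (hφ : IsQuasiGeometric φ)
    (hcompat : ∀ K₁ H₁ : Subgroup c𝒢.G, IsMaximalCompactSubgroup K₁ → IsMaximalCompactSubgroup H₁ →
      K₁ ≠ H₁ → K₁ ⊓ H₁ ≠ ⊥ → ∃ K₂ H₂ : Subgroup cℋ.G, IsMaximalCompactSubgroup K₂ ∧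
        IsMaximalCompactSubgroup H₂ ∧ K₂ ≠ H₂ ∧ K₁.map φ.toMonoidHom ≤ K₂ ∧ H₁.map φ.toMonoidHom ≤ H₂) :
    ∃ F : Hom 𝒢 ℋ, F.IsLocallyOpen ∧ F.CompatV c𝒢 cℋ φ ∧ F.CompatE c𝒢 cℋ φ := by
  classical
  have h𝒢37 := h𝒢.thm37Hypotheses
  have hℋ37 := hℋ.thm37Hypotheses
  haveI := TemperedPiChart.t2Space cℋ
  haveI := TemperedPiChart.t2Space c𝒢
  obtain ⟨hmax𝒢, -⟩ := h37iv 𝒢 h𝒢37 c𝒢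
  obtain ⟨hmaxℋ, -⟩ := h37iv ℋ hℋ37 cℋ
  -- verticial homomorphisms
  choose ψ hψ using exists_isVerticialHom_of_thm37i h37i h𝒢37 c𝒢
  choose Ψ hΨ using exists_isVerticialHom_of_thm37i h37i hℋ37 cℋ
  -- the vertex map and the verticial homomorphisms `χ v` of `H` hosting the images
  obtain ⟨fV, hfV, -⟩ :=
    existsUnique_vertexMap_of_isQuasiGeometric h37i h37ii h37iv h𝒢37 hℋ37 c𝒢 cℋ φ hφ
  have hχ' : ∀ v, ∃ χ : ℋ.Gv (fV v) →ₜ* cℋ.G, IsVerticialHom cℋ (fV v) χ ∧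
      MapsOntoOpenSubgroupOf φ.toMonoidHom (ψ v).toMonoidHom.range χ.toMonoidHom.range := by
    intro v
    obtain ⟨K₂, ⟨χ, hχ, rfl⟩, hm⟩ := hfV v _ (range_mem_verticialSubgroups c𝒢 (ψ v) (hψ v))
    exact ⟨χ, hχ, hm⟩
  choose χ hχ hmapsV using hχ'
  have hinjχ : ∀ v, Function.Injective (χ v) := fun v => (h37i ℋ hℋ37 cℋ (fV v)).2 (χ v) (hχ v)
  have hliftV : ∀ v, ∃ γ : 𝒢.Gv v →ₜ* ℋ.Gv (fV v), ∀ y, χ v (γ y) = (φ.comp (ψ v)) y := fun v =>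
    exists_lift_of_range_le (φ.comp (ψ v)) (χ v) (hinjχ v) (by
      rintro _ ⟨y, rfl⟩; exact (hmapsV v).1 ⟨ψ v y, ⟨y, rfl⟩, rfl⟩)
  choose hV hhV' using hliftV
  have hhV : ∀ v y, χ v (hV v y) = φ (ψ v y) := fun v y => by simpa using hhV' v y
  -- injective edge homomorphisms of `G`, the edge map, the edge homomorphisms `χE e` of `H`
  choose ψE hψE hinjψE using exists_isEdgeHom_injective_of_edge h37i h𝒢 c𝒢
  obtain ⟨fE, hfE, -⟩ :=
    existsUnique_edgeMap_of_isQuasiGeometric h37i h37iv hED h𝒢 hℋ c𝒢 cℋ φ hφ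
  have hχE' : ∀ e, ∃ χ' : ℋ.Ge (fE e) →ₜ* cℋ.G, IsEdgeHom cℋ (fE e) χ' ∧
      MapsOntoOpenSubgroupOf φ.toMonoidHom (ψE e).toMonoidHom.range χ'.toMonoidHom.range := by
    intro e
    obtain ⟨L₂, ⟨χ', hχ', rfl⟩, hm⟩ := hfE e _ ⟨ψE e, hψE e, rfl⟩
    exact ⟨χ', hχ', hm⟩
  choose χE hχE hmapsE using hχE'
  have hinjχE : ∀ e, Function.Injective (χE e) := fun e =>
    injective_of_isEdgeHom_of_edge h37i hℋ cℋ (χE e) (hχE e)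
  have hliftE : ∀ e, ∃ η : 𝒢.Ge e →ₜ* ℋ.Ge (fE e), ∀ x, χE e (η x) = (φ.comp (ψE e)) x := fun e =>
    exists_lift_of_range_le (φ.comp (ψE e)) (χE e) (hinjχE e) (by
      rintro _ ⟨x, rfl⟩; exact (hmapsE e).1 ⟨ψE e x, ⟨x, rfl⟩, rfl⟩)
  choose hE hhE' using hliftE
  have hhE : ∀ e x, χE e (hE e x) = φ (ψE e x) := fun e x => by simpa using hhE' e x
  -- the vertex of a branch (G is a graph)
  have habuts : ∀ b : 𝒢.graph.Branch, ∃ v, 𝒢.graph.abuts b = some v := fun b =>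
    Option.isSome_iff_exists.mp (h𝒢.isGraph.abuts_isSome b)
  choose vtx hvtx using habuts
  have hvtx_eq : ∀ {b : 𝒢.graph.Branch} {v : 𝒢.graph.Vertex}, 𝒢.graph.abuts b = some v → v = vtx b :=
    fun {b v} h => Option.some_injective _ (h.symm.trans (hvtx b))
  -- conjugators `a_b`: `ψ_v ∘ b_* = γ_{a_b} ∘ ψE_e`
  have ha' : ∀ b : 𝒢.graph.Branch, ∃ a : c𝒢.G, ∀ x,
      a * ψE (𝒢.graph.edgeOf b) x * a⁻¹ = ψ (vtx b) (𝒢.brHom b (vtx b) (hvtx b) x) := fun b =>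
    exists_conj_comp_brHom c𝒢 (hvtx b) (ψ (vtx b)) (hψ (vtx b)) (ψE _) (hψE _)
  choose a ha using ha'
  -- the target branches with their 2-cells
  have hcore : ∀ b : 𝒢.graph.Branch, ∃ (b' : ℋ.graph.Branch)
      (q : ℋ.graph.edgeOf b' = fE (𝒢.graph.edgeOf b))
      (h' : ℋ.graph.abuts b' = some (fV (vtx b))) (k : cℋ.G) (γ : ℋ.Gv (fV (vtx b))),
      (∀ y, k * χE (𝒢.graph.edgeOf b) y * k⁻¹ =
          Ψ (fV (vtx b)) (ℋ.brHomAt b' (fV (vtx b)) h' (fE (𝒢.graph.edgeOf b)) q y)) ∧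
      (χ (vtx b)).toMonoidHom.range.map (MulAut.conj (φ (a b))⁻¹).toMonoidHom =
        (Ψ (fV (vtx b))).toMonoidHom.range.map (MulAut.conj k⁻¹).toMonoidHom ∧
      ∀ x, hV (vtx b) (𝒢.brHom b (vtx b) (hvtx b) x) =
        γ * ℋ.brHomAt b' (fV (vtx b)) h' (fE (𝒢.graph.edgeOf b)) q (hE (𝒢.graph.edgeOf b) x) * γ⁻¹ :=
    fun b => exists_target_branch_comm h37i h37ii h37iii hℋ c𝒢 cℋ φ Ψ hΨ (ψ (vtx b)) (χ (vtx b))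
      (hχ (vtx b)) (hV (vtx b)) (hhV (vtx b)) (hvtx b) (ψE (𝒢.graph.edgeOf b)) (a b) (ha b)
      (χE (𝒢.graph.edgeOf b)) (hχE _) (hE _) (hhE _) (hmapsE _)
  choose fB hqB hhB kB γB hkB hhostB hcommB using hcore
  -- the hosts `Wt b` of the images and their source hosts `V b`
  have hWt : ∀ b, (χ (vtx b)).toMonoidHom.range.map (MulAut.conj (φ (a b))⁻¹).toMonoidHom ∈
      verticialSubgroups cℋ (fV (vtx b)) := fun b =>
    conj_mem_verticialSubgroups cℋ (range_mem_verticialSubgroups cℋ (χ (vtx b)) (hχ (vtx b))) _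
  have hVb : ∀ b, (ψ (vtx b)).toMonoidHom.range.map (MulAut.conj (a b)⁻¹).toMonoidHom ∈
      verticialSubgroups c𝒢 (vtx b) := fun b =>
    conj_mem_verticialSubgroups c𝒢 (range_mem_verticialSubgroups c𝒢 (ψ (vtx b)) (hψ (vtx b))) _
  have hLV : ∀ b, (ψE (𝒢.graph.edgeOf b)).toMonoidHom.range ≤
      ((𝒢.branchSubgroup b (vtx b) (hvtx b)).map (ψ (vtx b)).toMonoidHom).map
        (MulAut.conj (a b)⁻¹).toMonoidHom := by
    intro b
    rintro _ ⟨x, rfl⟩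
    refine ⟨ψ (vtx b) (𝒢.brHom b (vtx b) (hvtx b) x), ⟨_, ⟨x, rfl⟩, rfl⟩, ?_⟩
    show (a b)⁻¹ * ψ (vtx b) (𝒢.brHom b (vtx b) (hvtx b) x) * (a b)⁻¹⁻¹ = ψE _ x
    rw [← ha b x]; group
  -- the image of `V b` lies in `Wt b`, onto an open subgroup
  have hmapsVb : ∀ b, MapsOntoOpenSubgroupOf φ.toMonoidHom
      ((ψ (vtx b)).toMonoidHom.range.map (MulAut.conj (a b)⁻¹).toMonoidHom)
      ((χ (vtx b)).toMonoidHom.range.map (MulAut.conj (φ (a b))⁻¹).toMonoidHom) := by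
    intro b
    obtain ⟨W₀, hW₀, hm⟩ := hfV (vtx b) _ (hVb b)
    have hle : ((ψ (vtx b)).toMonoidHom.range.map (MulAut.conj (a b)⁻¹).toMonoidHom).map φ.toMonoidHom ≤
        (χ (vtx b)).toMonoidHom.range.map (MulAut.conj (φ (a b))⁻¹).toMonoidHom := by
      rintro _ ⟨_, ⟨_, ⟨y, rfl⟩, rfl⟩, rfl⟩
      refine ⟨φ (ψ (vtx b) y), ⟨hV (vtx b) y, hhV (vtx b) y⟩, ?_⟩
      show (φ (a b))⁻¹ * φ (ψ (vtx b) y) * ((φ (a b))⁻¹)⁻¹ =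
        φ ((a b)⁻¹ * ψ (vtx b) y * ((a b)⁻¹)⁻¹)
      simp only [map_mul, map_inv]
    have := host_eq_of_mapsOnto h37ii hℋ37 cℋ φ.toMonoidHom hW₀ hm (hWt b) hle
    rw [this]; exact hm
  -- NON-FOLDING: the two branches of an edge go to different branches
  have hinjB : ∀ b₁ b₂ : 𝒢.graph.Branch, 𝒢.graph.edgeOf b₁ = 𝒢.graph.edgeOf b₂ →
      fB b₁ = fB b₂ → b₁ = b₂ := by
    intro b₁ b₂ heq hfb
    by_contra hne
    -- the source hosts are distinct maximal compact subgroups meeting nontrivially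
    have hL0 : (ψE (𝒢.graph.edgeOf b₁)).toMonoidHom.range ≠ ⊥ := by
      intro h0
      haveI := infinite_of_mem_edgeLikeSubgroups h37i h𝒢37 c𝒢
        (⟨ψE _, hψE (𝒢.graph.edgeOf b₁), rfl⟩ :
          (ψE (𝒢.graph.edgeOf b₁)).toMonoidHom.range ∈ edgeLikeSubgroups c𝒢 _)
      rw [h0] at this
      exact not_finite (⊥ : Subgroup c𝒢.G)
    have hLV₂ : (ψE (𝒢.graph.edgeOf b₁)).toMonoidHom.range ≤
        ((𝒢.branchSubgroup b₂ (vtx b₂) (hvtx b₂)).map (ψ (vtx b₂)).toMonoidHom).map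
          (MulAut.conj (a b₂)⁻¹).toMonoidHom := by rw [heq]; exact hLV b₂
    have hVne : (ψ (vtx b₁)).toMonoidHom.range.map (MulAut.conj (a b₁)⁻¹).toMonoidHom ≠
        (ψ (vtx b₂)).toMonoidHom.range.map (MulAut.conj (a b₂)⁻¹).toMonoidHom := fun hEq =>
      hne (branch_eq_of_hosts_eq h37ii h37i h𝒢37 c𝒢 ψ hψ hL0 (hvtx b₁) (hvtx b₂) (a b₁)⁻¹ (a b₂)⁻¹
        (hLV b₁) hLV₂ hEq)
    have hVmeet : (ψ (vtx b₁)).toMonoidHom.range.map (MulAut.conj (a b₁)⁻¹).toMonoidHom ⊓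
        (ψ (vtx b₂)).toMonoidHom.range.map (MulAut.conj (a b₂)⁻¹).toMonoidHom ≠ ⊥ := fun h0 =>
      hL0 (le_bot_iff.mp (h0 ▸ le_inf ((hLV b₁).trans (Subgroup.map_mono (Subgroup.map_le_range _ _)))
        (hLV₂.trans (Subgroup.map_mono (Subgroup.map_le_range _ _)))))
    obtain ⟨K₂, K₂', hK₂, hK₂', hKne, hle₁, hle₂⟩ := hcompat _ _ ((hmax𝒢 _).mpr ⟨_, hVb b₁⟩)
      ((hmax𝒢 _).mpr ⟨_, hVb b₂⟩) hVne hVmeet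
    obtain ⟨u₁, hK₂u⟩ := (hmaxℋ K₂).mp hK₂
    obtain ⟨u₂, hK₂'u⟩ := (hmaxℋ K₂').mp hK₂'
    have hK₂eq := host_eq_of_mapsOnto h37ii hℋ37 cℋ φ.toMonoidHom (hWt b₁) (hmapsVb b₁) hK₂u hle₁
    have hK₂'eq := host_eq_of_mapsOnto h37ii hℋ37 cℋ φ.toMonoidHom (hWt b₂) (hmapsVb b₂) hK₂'u hle₂
    -- so the image hosts differ; but the common target branch forces them to agree
    apply hKne
    rw [hK₂eq, hK₂'eq, hhostB b₁, hhostB b₂]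
    -- align the vertices `fV (vtx b₁) = fV (vtx b₂)` and edges
    have hw : fV (vtx b₁) = fV (vtx b₂) :=
      Option.some_injective _ ((hhB b₁).symm.trans (hfb ▸ hhB b₂))
    -- subgroup-level conjugacy data for the common branch
    have hsub : ∀ b : 𝒢.graph.Branch,
        (χE (𝒢.graph.edgeOf b)).toMonoidHom.range.map (MulAut.conj (kB b)).toMonoidHom ≤
          (ℋ.branchSubgroup (fB b) (fV (vtx b)) (hhB b)).map (Ψ (fV (vtx b))).toMonoidHom := by
      intro b
      rintro _ ⟨_, ⟨y, rfl⟩, rfl⟩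
      exact ⟨ℋ.brHomAt (fB b) (fV (vtx b)) (hhB b) _ (hqB b) y,
        brHomAt_mem_branchSubgroup (hhB b) (hqB b) y, (hkB b y).symm⟩
    -- transport the `b₂` data to the indices of `b₁`
    have key : ∀ (w₁ w₂ : ℋ.graph.Vertex) (hw : w₁ = w₂) (c : ℋ.graph.Branch)
        (h₁ : ℋ.graph.abuts c = some w₁) (h₂ : ℋ.graph.abuts c = some w₂),
        (ℋ.branchSubgroup c w₂ h₂).map (Ψ w₂).toMonoidHom =
          (ℋ.branchSubgroup c w₁ h₁).map (Ψ w₁).toMonoidHom ∧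
        ∀ k : cℋ.G, (Ψ w₂).toMonoidHom.range.map (MulAut.conj k).toMonoidHom =
          (Ψ w₁).toMonoidHom.range.map (MulAut.conj k).toMonoidHom := by
      intro w₁ w₂ hw c h₁ h₂; subst hw; exact ⟨rfl, fun _ => rfl⟩
    obtain ⟨hbr, hrg⟩ := key _ _ hw (fB b₁) (hhB b₁) (hfb ▸ hhB b₂)
    have hsub₂ : (χE (𝒢.graph.edgeOf b₁)).toMonoidHom.range.map (MulAut.conj (kB b₂)).toMonoidHom ≤
        (ℋ.branchSubgroup (fB b₁) (fV (vtx b₁)) (hhB b₁)).map (Ψ (fV (vtx b₁))).toMonoidHom := by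
      have h2 := hsub b₂
      rw [← heq] at h2
      -- `fB b₂ = fB b₁` in the branch subgroup
      have key2 : ∀ (c₁ c₂ : ℋ.graph.Branch) (hc : c₁ = c₂) (h₁ : ℋ.graph.abuts c₁ = some (fV (vtx b₂)))
          (h₂ : ℋ.graph.abuts c₂ = some (fV (vtx b₂))),
          (ℋ.branchSubgroup c₂ _ h₂).map (Ψ _).toMonoidHom = (ℋ.branchSubgroup c₁ _ h₁).map (Ψ _).toMonoidHom := by
        intro c₁ c₂ hc h₁ h₂; subst hc; rfl
      rw [key2 (fB b₁) (fB b₂) hfb (hfb ▸ hhB b₂) (hhB b₂)] at h2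
      rwa [hbr] at h2
    rw [hrg (kB b₂)⁻¹]
    exact host_unique_of_branch h37i h37ii h37iii hℋ cℋ Ψ hΨ (χE (𝒢.graph.edgeOf b₁)) (hχE _)
      (hhB b₁) (hqB b₁) (kB b₁) (kB b₂) (hsub b₁) hsub₂
  -- the morphism
  refine ⟨{ base :=
              { vertexMap := fV
                edgeMap := fE
                branchMap := fB
                edgeOf_branchMap := hqB
                branchMap_injOn := hinjB
                abuts_branchMap := fun b v h => by rw [hvtx_eq h]; exact hhB b }
            hV := hV
            hE := hE
            comm := fun b v h => by
              have hv := hvtx_eq h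
              subst hv
              exact ⟨γB b, fun x => by rw [hcommB b x, brHomAt_apply]⟩ }, ⟨?_, ?_⟩, ?_, ?_⟩
  · -- open image on vertices
    intro v
    refine isOpen_range_lift (χ v) (hV v) ((ψ v).toMonoidHom.range.map φ.toMonoidHom)
      (fun y => ⟨ψ v y, ⟨y, rfl⟩, (hhV v y).symm⟩) (fun y hy => ?_) (hmapsV v).2
    obtain ⟨_, ⟨x, rfl⟩, hx⟩ := hy
    refine ⟨x, hinjχ v ?_⟩
    change φ (ψ v x) = χ v y at hx
    rw [← hhV v x] at hx
    exact hx
  · -- open image on edges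
    intro e
    refine isOpen_range_lift (χE e) (hE e) ((ψE e).toMonoidHom.range.map φ.toMonoidHom)
      (fun x => ⟨ψE e x, ⟨x, rfl⟩, (hhE e x).symm⟩) (fun y hy => ?_) (hmapsE e).2
    obtain ⟨_, ⟨x, rfl⟩, hx⟩ := hy
    refine ⟨x, hinjχE e ?_⟩
    change φ (ψE e x) = χE e y at hx
    rw [← hhE e x] at hx
    exact hx
  · -- compatibility on verticial homomorphisms
    intro v ψ₁ ψ₁' hψ₁ hψ₁'
    obtain ⟨s, hs⟩ := exists_conj_of_isVerticialHom c𝒢 (ψ v) ψ₁ (hψ v) hψ₁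
    obtain ⟨t, ht⟩ := exists_conj_of_isVerticialHom cℋ ψ₁' (χ v) hψ₁' (hχ v)
    refine ⟨φ s * t, fun x => ?_⟩
    show φ (ψ₁ x) = φ s * t * ψ₁' (hV v x) * (φ s * t)⁻¹
    rw [← hs, map_mul, map_mul, map_inv, ← hhV, ← ht]
    group
  · -- compatibility on edge homomorphisms
    intro e ψ₁ ψ₁' hψ₁ hψ₁'
    obtain ⟨s, hs⟩ := exists_conj_of_isEdgeHom c𝒢 (ψE e) ψ₁ (hψE e) hψ₁
    obtain ⟨t, ht⟩ := exists_conj_of_isEdgeHom cℋ ψ₁' (χE e) hψ₁' (hχE e)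
    refine ⟨φ s * t, fun x => ?_⟩
    show φ (ψ₁ x) = φ s * t * ψ₁' (hE e x) * (φ s * t)⁻¹
    rw [← hs, map_mul, map_mul, map_inv, ← hhE, ← ht]
    group

end ProfiniteSemiGraph

end Literature.AnabelianGeometry.SemiGraphs
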